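import Literature.LinearAlgebra.QuadraticForm.PosComplexStructuresPolarizationIsogenyLocalSystems
import Mathlib.Topology.ContinuousOn
import HarnessLib

/-!
# The Riemann form `ψ` and the Hodge form `ψ(·, J·)` on the homology local system of Deligne's family:
# `ψ_ℤ : R₁ ×_{Γ\X⁺} R₁ → ℤ` is locally constant and monodromy-invariant (a flat alternating pairing,
# non-degenerate), `(J, v, w) ↦ ψ(v, Jw)` is a continuous, symmetric, positive-definite form on the
# fibres — the family `Γ\B → Γ\X⁺` is POLARIZED by `ψ`

Topic `LinearAlgebra/QuadraticForm`; sequel of `QuadraticForm/PosComplexStructuresLatticeLocalSystem` (the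
homology local system `R₁ = LatticeSystem k ψ Λ G = Γ\(X⁺ × V(ℤ))`, `latticeAction`, its monodromy
`monodromy_latticeSystemMk = ρ`), `QuadraticForm/PosComplexStructuresPolarizationClass` (the integral Riemann
form `ψ_ℤ = psiLattice hψΛ`, `Γ(1)`-invariant: `psiLattice_restrictLattice`),
`QuadraticForm/PosComplexStructuresPolarizationIsogenyLocalSystems` (`psiLattice_injective`) and
`QuadraticForm/PosComplexStructuresCupProductLocalSystems` (the pattern of fibre-product local systems), with
the generic `Topology/CoveringSpaces/AssociatedCovering{,Maps,Monodromy}`.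

SOURCES (held, read at the page; VERBATIM). P. Deligne (notes by J. S. Milne), *Hodge cycles on abelian
varieties*, LNM 900 [Deligne1982HodgeCycles], proof of Thm. 4.8 (held `paper:doi-10-1007-978-3-540-38955-2-3`
p0032–p0034): p. 48 «there exists a Riemann form `ψ` …», (a′) «`ψ(Jx, Jy) = ψ(x, y)`», (b′) «`ψ(x, Jx) > 0`
for `x ≠ 0`», p. 49 «`X⁺` … the set of `J` satisfying (a′), (b′)», p. 50 «`Θ₁` the polarization with Riemann
form `ψ`», «the set of `𝒪_E`-isomorphisms `g : V(ℤ) → V(ℤ)` preserving `ψ`», «`Γ` acts on `X⁺` by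
`J ↦ g ∘ J ∘ g⁻¹` and (compatibly) on `B`». C. Voisin, *Hodge Theory and Complex Algebraic Geometry II*
[VoisinHodgeII2003] §3.1.1 (held p0088–p0090): (3.1), Cor. 3.10, Def. 3.13 (local systems, flat sections,
monodromy). J. Carlson, S. Müller-Stach, C. Peters [CarlsonMullerStachPeters2017] Thm. C.4.3 (local systems =
`π₁`-modules), Def. 4.1.3. H. Lange [Lange2023AbelianVarietiesComplex] §1.4.2 (before Prop. 1.4.7): «`φ_L`
is an isogeny if and only if … the alternating form `Im H` is non-degenerate».

## What is formalised (`Γ(1) = arithmeticGroup k ψ Λ`, `G ≤ Γ(1)`; `hψΛ : ψ(V(ℤ), V(ℤ)) ⊆ ℤ`;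
## `hψ : ψ` alternating; `hnd : ψ` non-degenerate)

* §1 the diagonal `Γ(1)`-set `V(ℤ) × V(ℤ)` (`latticeProdAction`, reducible, no instance) and **the fibre
  product `R₁ ×_{Γ\X⁺} R₁ = LatticeProdSystem G = Γ\(X⁺ × V(ℤ) × V(ℤ))`** (`latticeProdSystemMk`,
  `_eq_iff`, the projections `latticeProdFst/Snd` to `R₁`, the swap `latticeProdSwap`; over `Γ\X⁺` for
  torsion-free `G`: `latticeProdSystemProj`, ★ `isCoveringMap_latticeProdSystemProj`, ★
  `monodromy_latticeProdSystemMk` — diagonal monodromy `(ρ, ρ)`).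
* §2 ★★ `riemannFormMap G hψΛ : Γ\(X⁺ × V(ℤ) × V(ℤ)) → ℤ`, `[(J, v, w)] ↦ ψ_ℤ(v, w)` — **THE RIEMANN
  FORM IS A MORPHISM OF LOCAL SYSTEMS `R₁ ⊗ R₁ → ℤ`**: well defined by «preserving `ψ`», continuous and
  locally constant (`continuous_riemannFormMap`, `isLocallyConstant_riemannFormMap`), ★★ monodromy-invariant
  (`riemannFormMap_monodromy`), alternating (`riemannFormMap_latticeProdSwap`, `riemannFormMap_self`),
  fibrewise non-degenerate (`exists_riemannFormMap_ne_zero`).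
* §3 ★★ `hodgeFormMap G : Γ\(X⁺ × V(ℤ) × V(ℤ)) → ℝ`, `[(J, v, w)] ↦ ψ(v, Jw)` — **THE HODGE FORM of the
  fibre `(V, J)`** as a function on the fibre product: well defined (`Γ` acts «compatibly»), ★ CONTINUOUS
  (`continuous_hodgeFormMap`: it varies continuously with `J`), SYMMETRIC (`hodgeFormMap_latticeProdSwap`)
  and ★★ POSITIVE DEFINITE (`hodgeFormMap_pos`) — with §2: every fibre `(V(ℤ), J, ψ)` is a polarized
  weight-`−1` Hodge structure and `ψ` is flat: the family is polarized by `ψ` («`Θ₁` the polarization with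
  Riemann form `ψ`»).

Definitions with bodies, theorems; no `sorry`; no named facts; no instances (`letI`); no notation.

## References

* [Deligne1982HodgeCycles] P. Deligne, *Hodge cycles on abelian varieties*, in LNM 900, Springer 1982,
  proof of Thm. 4.8, pp. 48–50.
* [VoisinHodgeII2003] C. Voisin, *Hodge Theory and Complex Algebraic Geometry II*, CUP 2003, §3.1.1.
* [CarlsonMullerStachPeters2017] J. Carlson, S. Müller-Stach, C. Peters, *Period Mappings and Period
  Domains*, 2nd ed., CUP 2017, Def. 4.1.3, Thm. C.4.3.
* [Lange2023AbelianVarietiesComplex] H. Lange, *Abelian Varieties over the Complex Numbers*, Springer 2023,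
  §1.4.2.
* [HatcherAT2002] A. Hatcher, *Algebraic Topology*, CUP 2002, §1.3 p. 70.
-/

noncomputable section

open MulAction Function Set
open Literature.Topology.CoveringSpaces Literature.Topology.CoveringSpaces.AssocCovering

namespace Literature.LinearAlgebra.QuadraticForm

namespace arithmeticGroup

variable {V : Type*} [NormedAddCommGroup V] [NormedSpace ℝ V]
variable {k : V →L[ℝ] V} {ψ : LinearMap.BilinForm ℝ V} {Λ : Submodule ℤ V}

/-! ### §1 The fibre product `R₁ ×_{Γ\X⁺} R₁ = Γ\(X⁺ × V(ℤ) × V(ℤ))` -/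

variable (k ψ Λ) in
/-- `Γ(1)` acts on `V(ℤ) × V(ℤ)` diagonally, `γ • (v, w) = (γv, γw)` (reducible `MulAction` definition,
no instance: summon with `letI`). [cite: Deligne1982HodgeCycles, proof of Thm. 4.8, p. 50] -/
@[reducible] def latticeProdAction : MulAction (arithmeticGroup k ψ Λ) (Λ × Λ) :=
  letI := latticeAction k ψ Λ
  Prod.mulAction

variable (G : Subgroup (arithmeticGroup k ψ Λ))

/-- **The fibre product `R₁ ×_{Γ\X⁺} R₁ = Γ\(X⁺ × V(ℤ) × V(ℤ))`** of the homology local system with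
itself (the associated covering of the diagonal `Γ`-set `V(ℤ) × V(ℤ)`) — the source of bilinear forms on
`R₁`. [cite: CarlsonMullerStachPeters2017, Thm. C.4.3] [cite: Deligne1982HodgeCycles, proof of Thm. 4.8, p. 50] -/
abbrev LatticeProdSystem : Type _ :=
  letI := latticeProdAction k ψ Λ
  AssocSpace G (posComplexStructures k ψ) (Λ × Λ)

/-- The class `[(J, v, w)]`. [cite: CarlsonMullerStachPeters2017, Thm. C.4.3] -/
def latticeProdSystemMk : posComplexStructures k ψ × (Λ × Λ) → LatticeProdSystem G :=
  letI := latticeProdAction k ψ Λ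
  assocMk

/-- `latticeProdSystemMk` is surjective. [cite: CarlsonMullerStachPeters2017, Thm. C.4.3] -/
theorem surjective_latticeProdSystemMk : Surjective (latticeProdSystemMk G) :=
  letI := latticeProdAction k ψ Λ
  surjective_assocMk

/-- Equality of classes: `[(J, p)] = [(J', p')]` iff `γ • J' = J` and `(γ p'₁, γ p'₂) = p` for some
`γ ∈ Γ`. [cite: CarlsonMullerStachPeters2017, Thm. C.4.3] -/
theorem latticeProdSystemMk_eq_iff (J J' : posComplexStructures k ψ) (p p' : Λ × Λ) :
    latticeProdSystemMk G (J, p) = latticeProdSystemMk G (J', p') ↔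
      ∃ γ : G, γ • J' = J ∧ (restrictLattice (γ : arithmeticGroup k ψ Λ).2 p'.1,
        restrictLattice (γ : arithmeticGroup k ψ Λ).2 p'.2) = p :=
  letI := latticeProdAction k ψ Λ
  assocMk_eq_iff

/-- The projection to the first factor `R₁`: `[(J, v, w)] ↦ [(J, v)]`. [cite: CarlsonMullerStachPeters2017, Thm. C.4.3] -/
def latticeProdFst : LatticeProdSystem G → LatticeSystem k ψ Λ G :=
  letI := latticeProdAction k ψ Λ
  letI := latticeAction k ψ Λ
  mapFibre (G := G) (E := posComplexStructures k ψ) (Prod.fst : Λ × Λ → Λ) fun _ _ ↦ rfl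

/-- The projection to the second factor `R₁`: `[(J, v, w)] ↦ [(J, w)]`. [cite: CarlsonMullerStachPeters2017, Thm. C.4.3] -/
def latticeProdSnd : LatticeProdSystem G → LatticeSystem k ψ Λ G :=
  letI := latticeProdAction k ψ Λ
  letI := latticeAction k ψ Λ
  mapFibre (G := G) (E := posComplexStructures k ψ) (Prod.snd : Λ × Λ → Λ) fun _ _ ↦ rfl

/-- The projections on classes. [cite: CarlsonMullerStachPeters2017, Thm. C.4.3] -/
@[simp] theorem latticeProdFst_mk_latticeProdSnd_mk (J : posComplexStructures k ψ) (v w : Λ) :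
    latticeProdFst G (latticeProdSystemMk G (J, (v, w))) = latticeSystemMk k ψ Λ G (J, v) ∧
      latticeProdSnd G (latticeProdSystemMk G (J, (v, w))) = latticeSystemMk k ψ Λ G (J, w) :=
  ⟨rfl, rfl⟩

/-- The swap `[(J, v, w)] ↦ [(J, w, v)]` of the fibre product. [cite: CarlsonMullerStachPeters2017, Thm. C.4.3] -/
def latticeProdSwap : LatticeProdSystem G → LatticeProdSystem G :=
  letI := latticeProdAction k ψ Λ
  mapFibre (G := G) (E := posComplexStructures k ψ) (Prod.swap : Λ × Λ → Λ × Λ) fun _ _ ↦ rfl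

/-- The swap on classes. [cite: CarlsonMullerStachPeters2017, Thm. C.4.3] -/
@[simp] theorem latticeProdSwap_mk (J : posComplexStructures k ψ) (v w : Λ) :
    latticeProdSwap G (latticeProdSystemMk G (J, (v, w))) = latticeProdSystemMk G (J, (w, v)) := rfl

/-- The projections and the swap are continuous. [cite: CarlsonMullerStachPeters2017, Thm. C.4.3] -/
theorem continuous_latticeProdFst_latticeProdSnd_latticeProdSwap :
    Continuous (latticeProdFst G) ∧ Continuous (latticeProdSnd G) ∧ Continuous (latticeProdSwap G) := by
  letI := latticeProdAction k ψ Λ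
  letI := latticeAction k ψ Λ
  exact ⟨continuous_mapFibre (fun _ _ ↦ rfl) continuous_fst, continuous_mapFibre (fun _ _ ↦ rfl) continuous_snd,
    continuous_mapFibre (fun _ _ ↦ rfl) continuous_swap⟩

/-! ### §2 The Riemann form `ψ_ℤ : R₁ ×_{Γ\X⁺} R₁ → ℤ` — a flat alternating pairing -/

/-- ★★ **The Riemann form on the fibre product: `[(J, v, w)] ↦ ψ_ℤ(v, w) ∈ ℤ`**, well defined because `Γ`
preserves `ψ` («isomorphisms … preserving `ψ`»). [cite: Deligne1982HodgeCycles, proof of Thm. 4.8, pp. 48–50]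
[cite: CarlsonMullerStachPeters2017, Thm. C.4.3] -/
def riemannFormMap (hψΛ : ∀ x ∈ Λ, ∀ y ∈ Λ, ∃ m : ℤ, ψ x y = m) : LatticeProdSystem G → ℤ :=
  letI := latticeProdAction k ψ Λ
  Quotient.lift (fun p : posComplexStructures k ψ × (Λ × Λ) ↦ psiLattice hψΛ p.2.1 p.2.2) (by
    rintro a b ⟨γ, rfl⟩
    exact psiLattice_restrictLattice hψΛ (γ : arithmeticGroup k ψ Λ) b.2.1 b.2.2)

/-- On classes: `ψ_ℤ(v, w)`. [cite: Deligne1982HodgeCycles, proof of Thm. 4.8, p. 48] -/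
@[simp] theorem riemannFormMap_mk (hψΛ : ∀ x ∈ Λ, ∀ y ∈ Λ, ∃ m : ℤ, ψ x y = m)
    (J : posComplexStructures k ψ) (v w : Λ) :
    riemannFormMap G hψΛ (latticeProdSystemMk G (J, (v, w))) = psiLattice hψΛ v w := rfl

/-- Its real value is `ψ(v, w)`. [cite: Deligne1982HodgeCycles, proof of Thm. 4.8, p. 48] -/
theorem cast_riemannFormMap_mk (hψΛ : ∀ x ∈ Λ, ∀ y ∈ Λ, ∃ m : ℤ, ψ x y = m)
    (J : posComplexStructures k ψ) (v w : Λ) :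
    ((riemannFormMap G hψΛ (latticeProdSystemMk G (J, (v, w))) : ℤ) : ℝ) = ψ (v : V) w := by
  rw [riemannFormMap_mk, cast_psiLattice]

/-- ★ **The Riemann form is continuous on the fibre product** (discrete fibres).
[cite: VoisinHodgeII2003, §3.1.1 (3.1)] [cite: CarlsonMullerStachPeters2017, Thm. C.4.3] -/
theorem continuous_riemannFormMap [DiscreteTopology Λ] (hψΛ : ∀ x ∈ Λ, ∀ y ∈ Λ, ∃ m : ℤ, ψ x y = m) :
    Continuous (riemannFormMap G hψΛ) :=
  continuous_quot_lift _
    ((continuous_of_discreteTopology (f := fun q : Λ × Λ ↦ psiLattice hψΛ q.1 q.2)).comp continuous_snd)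

/-- ★ **The Riemann form is locally constant on the fibre product** — a flat pairing `R₁ ⊗ R₁ → ℤ`.
[cite: VoisinHodgeII2003, §3.1.1 (3.1)] [cite: CarlsonMullerStachPeters2017, Thm. C.4.3] -/
theorem isLocallyConstant_riemannFormMap [DiscreteTopology Λ]
    (hψΛ : ∀ x ∈ Λ, ∀ y ∈ Λ, ∃ m : ℤ, ψ x y = m) : IsLocallyConstant (riemannFormMap G hψΛ) :=
  (IsLocallyConstant.iff_continuous _).2 (continuous_riemannFormMap G hψΛ)

/-- ★ **The Riemann form is alternating on the fibre product: `ψ_ℤ[(J, w, v)] = −ψ_ℤ[(J, v, w)]`.**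
[cite: Deligne1982HodgeCycles, proof of Thm. 4.8, p. 48] -/
theorem riemannFormMap_latticeProdSwap (hψ : ψ.IsAlt) (hψΛ : ∀ x ∈ Λ, ∀ y ∈ Λ, ∃ m : ℤ, ψ x y = m)
    (q : LatticeProdSystem G) :
    riemannFormMap G hψΛ (latticeProdSwap G q) = -riemannFormMap G hψΛ q := by
  obtain ⟨⟨J, v, w⟩, rfl⟩ := surjective_latticeProdSystemMk G q
  rw [latticeProdSwap_mk, riemannFormMap_mk, riemannFormMap_mk]
  apply Int.cast_injective (α := ℝ)
  rw [Int.cast_neg, cast_psiLattice, cast_psiLattice]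
  exact (LinearMap.IsAlt.neg hψ (v : V) w).symm

/-- `ψ_ℤ[(J, v, v)] = 0`. [cite: Deligne1982HodgeCycles, proof of Thm. 4.8, p. 48] -/
theorem riemannFormMap_self (hψ : ψ.IsAlt) (hψΛ : ∀ x ∈ Λ, ∀ y ∈ Λ, ∃ m : ℤ, ψ x y = m)
    (J : posComplexStructures k ψ) (v : Λ) :
    riemannFormMap G hψΛ (latticeProdSystemMk G (J, (v, v))) = 0 := by
  rw [riemannFormMap_mk, psiLattice_self hψ]

/-- ★ **The Riemann form is non-degenerate on every fibre**: for `v ≠ 0` in `V(ℤ)` there is `w ∈ V(ℤ)` with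
`ψ_ℤ[(J, v, w)] ≠ 0` («`φ_L` is an isogeny iff … `Im H` is non-degenerate»: `λ_ψ` is injective).
[cite: Lange2023AbelianVarietiesComplex, §1.4.2 (before Prop. 1.4.7)] [cite: Deligne1982HodgeCycles, proof of Thm. 4.8, p. 48] -/
theorem exists_riemannFormMap_ne_zero [DiscreteTopology Λ] [IsZLattice ℝ Λ] (hnd : ψ.Nondegenerate)
    (hψΛ : ∀ x ∈ Λ, ∀ y ∈ Λ, ∃ m : ℤ, ψ x y = m) (J : posComplexStructures k ψ) {v : Λ} (hv : v ≠ 0) :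
    ∃ w : Λ, riemannFormMap G hψΛ (latticeProdSystemMk G (J, (v, w))) ≠ 0 := by
  by_contra h
  push Not at h
  apply hv
  apply psiLattice_injective hnd hψΛ
  rw [map_zero]
  exact LinearMap.ext fun w ↦ by rw [LinearMap.zero_apply, ← riemannFormMap_mk G hψΛ J v w, h w]

section TorsionFree

variable {G}
variable [FiniteDimensional ℝ V] [DiscreteTopology Λ] [IsZLattice ℝ Λ]
  (htf : ∀ g : G, IsOfFinOrder g → g = 1)

/-- The projection `Γ\(X⁺ × V(ℤ) × V(ℤ)) → Γ\X⁺` (torsion-free `Γ`). [cite: Deligne1982HodgeCycles, proof of Thm. 4.8, p. 50] -/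
def latticeProdSystemProj : LatticeProdSystem G → Quotient (orbitRel G (posComplexStructures k ψ)) :=
  letI := latticeProdAction k ψ Λ
  assocProj (isQuotientCoveringMap_of_torsionFree G htf) (Λ × Λ)

/-- The projection on classes. [cite: Deligne1982HodgeCycles, proof of Thm. 4.8, p. 50] -/
@[simp] theorem latticeProdSystemProj_mk (J : posComplexStructures k ψ) (p : Λ × Λ) :
    latticeProdSystemProj htf (latticeProdSystemMk G (J, p)) = Quotient.mk _ J := rfl

/-- ★ The fibre product is a covering of `Γ\X⁺` (discrete fibre `V(ℤ) × V(ℤ)`).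
[cite: CarlsonMullerStachPeters2017, Thm. C.4.3] [cite: HatcherAT2002, §1.3 p. 70] -/
theorem isCoveringMap_latticeProdSystemProj : IsCoveringMap (latticeProdSystemProj htf (G := G)) := by
  letI := latticeProdAction k ψ Λ
  exact isCoveringMap_assocProj _

/-- The projections to `R₁` lie over `Γ\X⁺`. [cite: CarlsonMullerStachPeters2017, Thm. C.4.3] -/
theorem latticeSystemProj_latticeProdFst_latticeProdSnd (q : LatticeProdSystem G) :
    latticeSystemProj k ψ Λ G (latticeProdFst G q) = latticeProdSystemProj htf q ∧
      latticeSystemProj k ψ Λ G (latticeProdSnd G q) = latticeProdSystemProj htf q := by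
  obtain ⟨⟨J, v, w⟩, rfl⟩ := surjective_latticeProdSystemMk G q
  exact ⟨rfl, rfl⟩

/-- ★ **The monodromy of the fibre product is diagonal `(ρ, ρ)`**: along a loop `γ` at `[J₀]`,
`[(J₀, v, w)] ↦ [(J₀, g_γ v, g_γ w)]`, `g_γ = ((fundamentalGroupToMulOpposite γ).unop)⁻¹ ∈ Γ`.
[cite: CarlsonMullerStachPeters2017, Thm. C.4.3] [cite: VoisinHodgeII2003, §3.1.1 Def. 3.13] -/
theorem monodromy_latticeProdSystemMk (J₀ : posComplexStructures k ψ)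
    (γ : FundamentalGroup (Quotient (orbitRel G (posComplexStructures k ψ))) (Quotient.mk _ J₀))
    (v w : Λ) :
    ((((isCoveringMap_latticeProdSystemProj htf).monodromy γ
        (⟨latticeProdSystemMk G (J₀, (v, w)), rfl⟩ :
          latticeProdSystemProj htf (G := G) ⁻¹' {Quotient.mk _ J₀})) :
          latticeProdSystemProj htf (G := G) ⁻¹' {Quotient.mk _ J₀}) : LatticeProdSystem G) =
      latticeProdSystemMk G (J₀,
        (restrictLattice ((((isQuotientCoveringMap_of_torsionFree G htf).fundamentalGroupToMulOpposite
            ⟨J₀, rfl⟩ γ).unop)⁻¹ : G).1.2 v,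
          restrictLattice ((((isQuotientCoveringMap_of_torsionFree G htf).fundamentalGroupToMulOpposite
            ⟨J₀, rfl⟩ γ).unop)⁻¹ : G).1.2 w)) := by
  letI := latticeProdAction k ψ Λ
  exact monodromy_assocMk_eq_assocMk_smul (isQuotientCoveringMap_of_torsionFree G htf) J₀ γ (v, w)

/-- ★★ **THE RIEMANN FORM IS INVARIANT UNDER THE MONODROMY: `ψ_ℤ(monodromy_γ [(J₀, v, w)]) =
ψ_ℤ[(J₀, v, w)]`** — `ψ` is a flat pairing `R₁ ⊗ R₁ → ℤ_{Γ\X⁺}`, i.e. invariant under the monodromy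
representation `π₁(Γ\X⁺) → Γ ⊂ Aut(V(ℤ), ψ)`. [cite: Deligne1982HodgeCycles, proof of Thm. 4.8, p. 50]
[cite: VoisinHodgeII2003, §3.1.1 Def. 3.13, (3.1)] [cite: CarlsonMullerStachPeters2017, Def. 4.1.3, Thm. C.4.3] -/
theorem riemannFormMap_monodromy (hψΛ : ∀ x ∈ Λ, ∀ y ∈ Λ, ∃ m : ℤ, ψ x y = m)
    (J₀ : posComplexStructures k ψ)
    (γ : FundamentalGroup (Quotient (orbitRel G (posComplexStructures k ψ))) (Quotient.mk _ J₀))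
    (v w : Λ) :
    riemannFormMap G hψΛ ((((isCoveringMap_latticeProdSystemProj htf).monodromy γ
        (⟨latticeProdSystemMk G (J₀, (v, w)), rfl⟩ :
          latticeProdSystemProj htf (G := G) ⁻¹' {Quotient.mk _ J₀})) :
          latticeProdSystemProj htf (G := G) ⁻¹' {Quotient.mk _ J₀}) : LatticeProdSystem G) =
      riemannFormMap G hψΛ (latticeProdSystemMk G (J₀, (v, w))) := by
  rw [monodromy_latticeProdSystemMk, riemannFormMap_mk, riemannFormMap_mk]
  exact psiLattice_restrictLattice hψΛ _ v w

end TorsionFree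

/-! ### §3 The Hodge form `(J, v, w) ↦ ψ(v, Jw)`: continuous, symmetric, positive definite -/

/-- **`Γ` acts «compatibly»: `(γJγ⁻¹)(γw) = γ(Jw)`.** [cite: Deligne1982HodgeCycles, proof of Thm. 4.8, p. 50] -/
theorem coe_smul_apply_apply (γ : arithmeticGroup k ψ Λ) (J : posComplexStructures k ψ) (w : V) :
    ((γ • J : posComplexStructures k ψ) : V →L[ℝ] V) (((γ : (V →L[ℝ] V)ˣ) : V →L[ℝ] V) w) =
      ((γ : (V →L[ℝ] V)ˣ) : V →L[ℝ] V) ((J : V →L[ℝ] V) w) := by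
  rw [coe_smul, mul_apply_eq_comp, mul_apply_eq_comp, units_inv_apply_apply]

/-- **The Hodge form is `Γ(1)`-invariant: `ψ(γv, (γJγ⁻¹)(γw)) = ψ(v, Jw)`.**
[cite: Deligne1982HodgeCycles, proof of Thm. 4.8, p. 50 («preserving `ψ`», «(compatibly) on `B`»)] -/
theorem psi_smul_apply_smul (γ : arithmeticGroup k ψ Λ) (J : posComplexStructures k ψ) (v w : V) :
    ψ (((γ : (V →L[ℝ] V)ˣ) : V →L[ℝ] V) v)
        (((γ • J : posComplexStructures k ψ) : V →L[ℝ] V) (((γ : (V →L[ℝ] V)ˣ) : V →L[ℝ] V) w)) =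
      ψ v ((J : V →L[ℝ] V) w) := by
  rw [coe_smul_apply_apply, γ.2.1]

/-- ★★ **The Hodge form on the fibre product: `[(J, v, w)] ↦ ψ(v, Jw) ∈ ℝ`** — Deligne's positive form
(b′) of the fibre `(V, J)`, well defined on `Γ\(X⁺ × V(ℤ) × V(ℤ))`.
[cite: Deligne1982HodgeCycles, proof of Thm. 4.8, pp. 48–50] -/
def hodgeFormMap : LatticeProdSystem G → ℝ :=
  letI := latticeProdAction k ψ Λ
  Quotient.lift (fun p : posComplexStructures k ψ × (Λ × Λ) ↦
      ψ (p.2.1 : V) ((p.1 : V →L[ℝ] V) (p.2.2 : V))) (by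
    rintro a b ⟨γ, rfl⟩
    exact psi_smul_apply_smul (γ : arithmeticGroup k ψ Λ) b.1 (b.2.1 : V) (b.2.2 : V))

/-- On classes: `ψ(v, Jw)`. [cite: Deligne1982HodgeCycles, proof of Thm. 4.8, p. 48 (b′)] -/
@[simp] theorem hodgeFormMap_mk (J : posComplexStructures k ψ) (v w : Λ) :
    hodgeFormMap G (latticeProdSystemMk G (J, (v, w))) = ψ (v : V) ((J : V →L[ℝ] V) w) := rfl

/-- ★ **The Hodge form is continuous on the fibre product** (it varies continuously with the complex
structure `J ∈ X⁺`; the fibres are discrete). [cite: Deligne1982HodgeCycles, proof of Thm. 4.8, p. 49 («`X⁺`»)] -/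
theorem continuous_hodgeFormMap [FiniteDimensional ℝ V] [DiscreteTopology Λ] :
    Continuous (hodgeFormMap G) := by
  refine continuous_quot_lift _ (continuous_prod_of_discrete_right.2 fun q ↦ ?_)
  change Continuous fun J : posComplexStructures k ψ ↦ ψ (q.1 : V) ((J : V →L[ℝ] V) (q.2 : V))
  exact (ψ (q.1 : V)).continuous_of_finiteDimensional.comp
    ((ContinuousLinearMap.apply ℝ V (q.2 : V)).continuous.comp continuous_subtype_val)

/-- ★ **The Hodge form is symmetric: `ψ(w, Jv) = ψ(v, Jw)`** (`ψ(Jx, Jy) = ψ(x, y)`, `J² = −1`, `ψ`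
alternating). [cite: Deligne1982HodgeCycles, proof of Thm. 4.8, p. 48 (a′)] -/
theorem hodgeFormMap_latticeProdSwap (hψ : ψ.IsAlt) (q : LatticeProdSystem G) :
    hodgeFormMap G (latticeProdSwap G q) = hodgeFormMap G q := by
  obtain ⟨⟨J, v, w⟩, rfl⟩ := surjective_latticeProdSystemMk G q
  rw [latticeProdSwap_mk, hodgeFormMap_mk, hodgeFormMap_mk]
  -- `ψ(w, Jv) = ψ(Jw, JJv) = ψ(Jw, -v) = -ψ(Jw, v) = ψ(v, Jw)`
  have hJJ : (J : V →L[ℝ] V) ((J : V →L[ℝ] V) v) = -(v : V) := by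
    have h := congrArg (fun T : V →L[ℝ] V ↦ T (v : V)) J.2.1
    simpa [mul_apply_eq_comp] using h
  rw [← J.2.2.2.1 (w : V) ((J : V →L[ℝ] V) v), hJJ, map_neg, ← LinearMap.IsAlt.neg hψ (v : V), neg_neg]

/-- ★★ **The Hodge form is positive definite on every fibre: `ψ(v, Jv) > 0` for `v ≠ 0`** (Deligne's
(b′)). [cite: Deligne1982HodgeCycles, proof of Thm. 4.8, p. 48 (b′)] -/
theorem hodgeFormMap_pos (J : posComplexStructures k ψ) {v : Λ} (hv : v ≠ 0) :
    0 < hodgeFormMap G (latticeProdSystemMk G (J, (v, v))) := by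
  rw [hodgeFormMap_mk]
  exact J.2.2.2.2 (v : V) fun h ↦ hv (Subtype.ext h)

/-- `ψ(0, J0) = 0`. [cite: Deligne1982HodgeCycles, proof of Thm. 4.8, p. 48 (b′)] -/
theorem hodgeFormMap_zero (J : posComplexStructures k ψ) :
    hodgeFormMap G (latticeProdSystemMk G (J, (0, 0))) = 0 := by
  rw [hodgeFormMap_mk, Submodule.coe_zero, map_zero, LinearMap.zero_apply]

/-- ★ **The Hodge form is non-negative on the diagonal and vanishes only at `0`.**
[cite: Deligne1982HodgeCycles, proof of Thm. 4.8, p. 48 (b′)] -/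
theorem hodgeFormMap_self_eq_zero_iff (J : posComplexStructures k ψ) (v : Λ) :
    hodgeFormMap G (latticeProdSystemMk G (J, (v, v))) = 0 ↔ v = 0 := by
  constructor
  · intro h
    by_contra hv
    exact (hodgeFormMap_pos G J hv).ne' h
  · rintro rfl
    exact hodgeFormMap_zero G J

section HodgeTorsionFree

variable {G}
variable [FiniteDimensional ℝ V] [DiscreteTopology Λ] [IsZLattice ℝ Λ]
  (htf : ∀ g : G, IsOfFinOrder g → g = 1)

/-- ★ Along the monodromy the Hodge form at `J₀` is transported to the Hodge form of the translated
vectors: `h[monodromy_γ (J₀, v, w)] = ψ(g_γ v, J₀ g_γ w)` — the Hodge form is a continuous but in general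
NOT a flat pairing (only `ψ` is). [cite: VoisinHodgeII2003, §3.1.1 Def. 3.13] [cite: Deligne1982HodgeCycles, proof of Thm. 4.8, p. 50] -/
theorem hodgeFormMap_monodromy (J₀ : posComplexStructures k ψ)
    (γ : FundamentalGroup (Quotient (orbitRel G (posComplexStructures k ψ))) (Quotient.mk _ J₀))
    (v w : Λ) :
    hodgeFormMap G ((((isCoveringMap_latticeProdSystemProj htf).monodromy γ
        (⟨latticeProdSystemMk G (J₀, (v, w)), rfl⟩ :
          latticeProdSystemProj htf (G := G) ⁻¹' {Quotient.mk _ J₀})) :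
          latticeProdSystemProj htf (G := G) ⁻¹' {Quotient.mk _ J₀}) : LatticeProdSystem G) =
      ψ ((restrictLattice ((((isQuotientCoveringMap_of_torsionFree G htf).fundamentalGroupToMulOpposite
            ⟨J₀, rfl⟩ γ).unop)⁻¹ : G).1.2 v : Λ) : V)
        ((J₀ : V →L[ℝ] V) ((restrictLattice
          ((((isQuotientCoveringMap_of_torsionFree G htf).fundamentalGroupToMulOpposite
            ⟨J₀, rfl⟩ γ).unop)⁻¹ : G).1.2 w : Λ) : V)) := by
  rw [monodromy_latticeProdSystemMk, hodgeFormMap_mk]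

end HodgeTorsionFree

end arithmeticGroup

end Literature.LinearAlgebra.QuadraticForm
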